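import Summits.BirchSwinnertonDyer.BirchSwinnertonDyer.Theses.TangentCone
import Literature.NumberTheory.EllipticCurves.HeegnerPointsOfConductor
import Literature.NumberTheory.EllipticCurves.BSDHeegnerPoints

/-!
# Sketch — crux idea `heegner-kolyvagin-tame-derivative` for `SelmerRankLB` (stmt-0131): first lemmas

Crux-ideate seat `planner-cruxidea-stmt-BirchSwinnertonDyer-0131-2-0` (round 1, ideator k = 2).
Nothing here is proved; the two `def … : Prop` below are the TYPED first statements of the line
(they must elaborate over existing declarations — `lean check` rc 0).

* `HT41` — the FIRST OPEN SLICE of the crux on the Heegner–Kolyvagin side: for an even analytic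
  rank `r_an(E) ≥ 4` curve, an imaginary quadratic `K` in the Heegner configuration with
  `r_an(E^{(d_K)}) = 1`, a big-image good ordinary `p ≥ 5`, and EVERY single Kolyvagin prime `ℓ`,
  Kolyvagin's derivative class `c_M(ℓ) ∈ H¹(K, E[p^M])` (tree: `KolyvaginHeegnerData.kolyvaginClass`,
  i.e. the class of the explicit point `P(ℓ) = Σ_{σ∈S} σ D_ℓ y(ℓ) ∈ E(K[ℓ])`) VANISHES for every
  `1 ≤ M ≤ M(ℓ)`; equivalently `P(ℓ) ∈ p^M E(K[ℓ])`.
* `ZhangTransfer` — the transfer leaf (W. Zhang 2014, Thm 1.2 = Kolyvagin 1991 Thm 2.3 + Kolyvagin's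
  conjecture, specialised): under Zhang's Hypothesis ♠ (here in the sufficient squarefree form
  `N` squarefree and `p ∤ v_ℓ(Δ)` for all `ℓ ∣ N`, i.e. `ρ̄` ramified at every `ℓ ∣ N`), the
  vanishing of all single-prime classes forces `corank_p Sel_{p^∞}(E/ℚ) ≥ 4` (given `r_an(E)` even,
  `r_an(E^{(d_K)}) = 1`: then `r_p^-(E/K) = 1`, and `ord κ^∞ = max(r^+, r^-) - 1` with the parity clause
  excludes `ord κ^∞ = 2`, so `ord κ^∞ ≥ 2 ⟹ r^+ ≥ 4`).
-/

namespace Summit.BirchSwinnertonDyer.BirchSwinnertonDyer.Cruxes.SelmerRankLB.HeegnerKolyvaginTameDerivative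

open Literature.NumberTheory.EllipticCurves
open Literature.NumberTheory.EllipticCurves.ModularForms

/-- **HT(4,1)** — first open slice of `SelmerRankLB` read through Kolyvagin's Heegner system:
every single-prime Kolyvagin class of an even-analytic-rank-`≥ 4` curve vanishes.
Truth status: implied by `SelmerRankLB` (hence by BSD) via Kolyvagin 1991 Thm 2.3 and
Gross–Zagier (`P(1) = y_K` torsion); OPEN; first instance of the crux beyond `r_an ≤ 3`. -/
def HT41 : Prop :=
  ∀ (W : WeierstrassCurve ℚ) [W.IsElliptic] [W.IsGloballyMinimal] (p : ℕ) [hp : Fact p.Prime],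
    5 ≤ p → W.HasGoodReductionAtPrime p → ¬ (p : ℤ) ∣ W.frobeniusTrace p →
    W.HasSurjectiveModNGaloisRep p →
    4 ≤ W.analyticRank → Even W.analyticRank →
    ∀ (K : Type) [Field K] [NumberField K], IsImaginaryQuadratic K →
      NumberField.discr K ≠ -3 → NumberField.discr K ≠ -4 →
      ¬ ((p : ℤ) ∣ NumberField.discr K) →
      ∀ [NeZero (W.conductorNorm ℤ)],
        SatisfiesHeegnerHypothesis (W.conductorNorm ℤ) K →
        (W.quadraticTwist (NumberField.discr K : ℚ)).analyticRank = 1 →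
        ∀ (Dt : ModularParametrizationData W (W.conductorNorm ℤ)) (β : ℤ) (ι : K →+* ℂ)
          (ℓ : ℕ), Zhang2014.IsKolyvaginPrime (W.conductorNorm ℤ) W K p ℓ →
          ∀ (d : KolyvaginHeegnerData Dt β ι ℓ) (M : ℕ),
            1 ≤ M → M ≤ Zhang2014.kolyvaginIndex W p ℓ →
            d.kolyvaginClass hp.out M = 0

/-- **Transfer leaf (Zhang 2014 Thm 1.2 specialised; literature, XL)**: under Hypothesis ♠ in its
squarefree form, the vanishing of all single-prime Kolyvagin classes (at all admissible levels
`M ≤ M(ℓ)`, for all choices of the auxiliary data) gives `corank_{ℤ_p} Sel_{p^∞}(E/ℚ) ≥ 4`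
when `r_an(E)` is even `≥ 2` and `r_an(E^{(d_K)}) = 1`. -/
def ZhangTransfer : Prop :=
  ∀ (W : WeierstrassCurve ℚ) [W.IsElliptic] [W.IsGloballyMinimal] (p : ℕ) [hp : Fact p.Prime],
    5 ≤ p → W.HasGoodReductionAtPrime p → ¬ (p : ℤ) ∣ W.frobeniusTrace p →
    W.HasSurjectiveModNGaloisRep p →
    2 ≤ W.analyticRank → Even W.analyticRank →
    Squarefree (W.conductorNorm ℤ) →
    (∀ q : ℕ, q.Prime → q ∣ W.conductorNorm ℤ → ¬ ((p : ℤ) ∣ padicValRat q W.Δ)) →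
    ∀ (K : Type) [Field K] [NumberField K], IsImaginaryQuadratic K →
      NumberField.discr K ≠ -3 → NumberField.discr K ≠ -4 →
      ¬ ((p : ℤ) ∣ NumberField.discr K) →
      ∀ [NeZero (W.conductorNorm ℤ)],
        SatisfiesHeegnerHypothesis (W.conductorNorm ℤ) K →
        (W.quadraticTwist (NumberField.discr K : ℚ)).analyticRank = 1 →
        (∀ (Dt : ModularParametrizationData W (W.conductorNorm ℤ)) (β : ℤ) (ι : K →+* ℂ)
          (ℓ : ℕ), Zhang2014.IsKolyvaginPrime (W.conductorNorm ℤ) W K p ℓ →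
          ∀ (d : KolyvaginHeegnerData Dt β ι ℓ) (M : ℕ),
            1 ≤ M → M ≤ Zhang2014.kolyvaginIndex W p ℓ →
            d.kolyvaginClass hp.out M = 0) →
        4 ≤ W.selmerCorank p

/-- Shape check of the composition at the first open instance (bookkeeping; this is an idea card,
not a skeleton): `HT41 ∧ ZhangTransfer` give the (4,2) instance of the crux on squarefree-conductor
curves with `ρ̄` ramified at the bad primes, GIVEN an auxiliary `K` (supplied in a line by
BFH/Murty–Murty/Waldspurger twist non-vanishing). -/
example (h1 : HT41) (h2 : ZhangTransfer)
    (W : WeierstrassCurve ℚ) [W.IsElliptic] [W.IsGloballyMinimal] (p : ℕ) [hp : Fact p.Prime]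
    (h5 : 5 ≤ p) (hg : W.HasGoodReductionAtPrime p) (ho : ¬ (p : ℤ) ∣ W.frobeniusTrace p)
    (hs : W.HasSurjectiveModNGaloisRep p) (h4 : 4 ≤ W.analyticRank) (he : Even W.analyticRank)
    (hsq : Squarefree (W.conductorNorm ℤ))
    (hram : ∀ q : ℕ, q.Prime → q ∣ W.conductorNorm ℤ → ¬ ((p : ℤ) ∣ padicValRat q W.Δ))
    (K : Type) [Field K] [NumberField K] (hK : IsImaginaryQuadratic K)
    (h3 : NumberField.discr K ≠ -3) (h4' : NumberField.discr K ≠ -4)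
    (hpD : ¬ ((p : ℤ) ∣ NumberField.discr K)) [NeZero (W.conductorNorm ℤ)]
    (hH : SatisfiesHeegnerHypothesis (W.conductorNorm ℤ) K)
    (htw : (W.quadraticTwist (NumberField.discr K : ℚ)).analyticRank = 1) :
    4 ≤ W.selmerCorank p :=
  h2 W p h5 hg ho hs (le_trans (by norm_num) h4) he hsq hram K hK h3 h4' hpD hH htw
    (fun Dt β ι ℓ hℓ d M h1M hM => h1 W p h5 hg ho hs h4 he K hK h3 h4' hpD hH htw Dt β ι ℓ hℓ d M h1M hM)

end Summit.BirchSwinnertonDyer.BirchSwinnertonDyer.Cruxes.SelmerRankLB.HeegnerKolyvaginTameDerivative
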